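import Mathlib
import Summits.Ventures.HodgeRepro.Tier4.Target
import Summits.Ventures.HodgeRepro.Tier4.Common.TargetBall
import Summits.Ventures.HodgeRepro.Tier4.Common.TargetCalculus
import Summits.Ventures.HodgeRepro.Tier4.Common.TargetJacobian
import Summits.Ventures.HodgeRepro.Tier4.Common.AutForms
import Summits.Ventures.HodgeRepro.Tier4.Line3.BallChangeOfVariables
import Summits.Ventures.HodgeRepro.Tier4.Line3.DomainTransfer
import Summits.Ventures.HodgeRepro.Tier4.Line3.KernelIntegrable
import Summits.Ventures.HodgeRepro.Tier4.Line3.InvariantDensityTransfer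

/-!
# Tier4/Line3/GoodDomainCovering — the mass of an invariant density over a fundamental domain of a level is at most its
mass over the translates of a fundamental domain of the full group (transfer R6, part 4)

Blind re-derivation cell `pub-hodge-repro`, Tier 4 «PROVE THE STEP» (README §9–§10), LINE L3, seat t4-L2-p1 (on L3.5
with t4-L2-p3, lead S12654); support module for the residual `OffMainMass` of L3.5.  Mathlib-level.

* `lintegral_fundamentalDomain_le_of_cover`: the `≤` half of the transfer needs of the TARGET set only that it be
  measurable, inside the ball, and that almost every point of the ball have a `Γ′`-translate in it — NOT that it be
  a fundamental domain: `∫⁻_D ρ ≤ ∫⁻_S ρ` for `D` a fundamental domain of `Γ′`, `S` such a covering set and `ρ` an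
  invariant density.
* `ae_exists_translate_mem_iUnion`: if `F` is a fundamental domain of `Γ` and `R ⊆ Γ` a set of representatives of the
  left cosets of a subgroup `Γ′ ≤ Γ` (`∀ γ ∈ Γ, ∃ r ∈ R, ∃ δ ∈ Γ′, γ = r * δ` — t4-L2-p3's
  `exists_cosetReps_principalCongruence` with `Γ′ ⊇ Γ ∩ Γ(q₀^N)`), then almost every point of the ball has a
  `Γ′`-translate in `⋃_{r ∈ R} r⁻¹(F)`: `γ z ∈ F`, `γ = r δ`, so `δ z = r⁻¹ (γ z) ∈ r⁻¹ F`.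
* **`lintegral_domain_le_sum_translates`**: for a `Γ′`-invariant density `ρ` and a fundamental domain `D` of `Γ′`,
  `∫⁻_D ρ ≤ Σ_{r ∈ R} ∫⁻_{r⁻¹(F)} ρ`.  Applied to the off-main density of a level (`OffMainInvariance`) with the BHC
  fundamental domain `F` of `Γ` (LitCompactness row) this bounds the off-main mass of the level by `|R|` integrals over
  translates of ONE fixed relatively compact set — the shape of the residual `OffMainMass`: what remains is the
  pointwise bound of the off-main density on the ball (the class bound with the lattice Gaussian sums) and the
  distance of the translates `r⁻¹(F)` from the boundary (the archimedean size of the representatives).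
Nothing here asserts anything about the truth of (P); HC_CM is NOT proved by anyone in this repository.
-/

set_option autoImplicit false

noncomputable section

namespace Summit.Ventures.HodgeRepro.Tier4.Line3

open Summit.Ventures.HodgeRepro.Tier4
open Matrix MeasureTheory
open scoped ComplexConjugate ENNReal

section Cover

variable {E : Type*} [Field E] [NumberField E] {c : E ≃+* E} {H : Matrix (Fin 3) (Fin 3) E} {τ₀ : E →+* ℂ}
  {C : Matrix (Fin 3) (Fin 3) ℂ} {Γ' : Set (Matrix (Fin 3) (Fin 3) E)}

/-- **THE `≤` HALF OF THE TRANSFER WITH A COVERING TARGET**: `∫⁻_D ρ ≤ ∫⁻_S ρ` when almost every point of the ball has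
a translate in `S`. -/
theorem lintegral_fundamentalDomain_le_of_cover (hΓ : IsCongruenceSubgroup c H Γ') (hτ : ∀ x, τ₀ (c x) = conj (τ₀ x))
    (hC : IsSylvester (H.map τ₀) C) {D S : Set (Fin 2 → ℂ)}
    (hD : IsFundamentalDomainFor (ballActions τ₀ C Γ') D) (hS : MeasurableSet S) (hSb : S ⊆ ball)
    (hcov : ∀ᵐ z ∂(volume.restrict ball), ∃ φ ∈ ballActions τ₀ C Γ', φ z ∈ S)
    {ρ : (Fin 2 → ℂ) → ℝ≥0∞} (hρm : AEMeasurable ρ (volume.restrict ball)) (hρ : IsInvariantDensity τ₀ C Γ' ρ) :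
    ∫⁻ z in D, ρ z ≤ ∫⁻ z in S, ρ z := by
  haveI : Countable (ballActions τ₀ C Γ') := countable_ballActions
  let χ : ballActions τ₀ C Γ' → (Fin 2 → ℂ) → ℝ≥0∞ := fun φ z => S.indicator (fun _ => (1 : ℝ≥0∞)) (φ.1 z)
  have hχm : ∀ φ : ballActions τ₀ C Γ', Measurable (χ φ) := by
    intro φ
    obtain ⟨M, _, hφ⟩ := exists_unitaryJ_of_mem_ballActions hΓ hτ hC φ.2
    show Measurable (fun z => S.indicator (fun _ => (1 : ℝ≥0∞)) (φ.1 z))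
    rw [hφ]
    exact (measurable_const.indicator hS).comp (measurable_actM M)
  have hρD : AEMeasurable ρ (volume.restrict D) :=
    hρm.mono_measure (Measure.restrict_mono hD.2.1 le_rfl)
  have hcount : ∀ᵐ z ∂(volume.restrict D), 1 ≤ ∑' φ : ballActions τ₀ C Γ', χ φ z := by
    have h := ae_restrict_of_ae_restrict_of_subset hD.2.1 hcov
    filter_upwards [h] with z hz
    obtain ⟨φ, hφ, hφz⟩ := hz
    calc (1 : ℝ≥0∞) = χ ⟨φ, hφ⟩ z := by simp [χ, Set.indicator_of_mem hφz]
      _ ≤ ∑' φ : ballActions τ₀ C Γ', χ φ z := ENNReal.le_tsum _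
  have hpt : ∀ (φ : ballActions τ₀ C Γ'), ∀ z ∈ D, ρ z * χ φ z =
      ENNReal.ofReal (Complex.normSq (jacDetMap φ.1 z)) * S.indicator ρ (φ.1 z) := by
    intro φ z hz
    rw [← hρ φ.1 φ.2 z (hD.2.1 hz)]
    by_cases hφz : φ.1 z ∈ S
    · simp [χ, Set.indicator_of_mem hφz]
    · simp [χ, Set.indicator_of_notMem hφz]
  calc ∫⁻ z in D, ρ z ≤ ∫⁻ z in D, ρ z * ∑' φ : ballActions τ₀ C Γ', χ φ z :=
        lintegral_mono_ae (hcount.mono fun z hz => le_mul_of_one_le_right' hz)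
    _ = ∑' φ : ballActions τ₀ C Γ', ∫⁻ z in D, ρ z * χ φ z := by
        have hm : ∀ φ : ballActions τ₀ C Γ', AEMeasurable (fun z => ρ z * χ φ z) (volume.restrict D) :=
          fun φ => hρD.mul (hχm φ).aemeasurable
        rw [← lintegral_tsum hm]
        exact lintegral_congr fun z => ENNReal.tsum_mul_left.symm
    _ = ∑' φ : ballActions τ₀ C Γ',
          ∫⁻ z in D, ENNReal.ofReal (Complex.normSq (jacDetMap φ.1 z)) * S.indicator ρ (φ.1 z) :=
        tsum_congr fun φ => setLIntegral_congr_fun hD.1 (hpt φ)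
    _ = ∑' φ : ballActions τ₀ C Γ', ∫⁻ w in φ.1 '' D, S.indicator ρ w := by
        refine tsum_congr fun φ => ?_
        obtain ⟨M, hM, hφ⟩ := exists_unitaryJ_of_mem_ballActions hΓ hτ hC φ.2
        rw [hφ, lintegral_image_actM hM hD.1 hD.2.1]
    _ = ∫⁻ w in ball, S.indicator ρ w := (lintegral_ball_eq_tsum_image_generic hΓ hτ hC hD _).symm
    _ = ∫⁻ w in S, ρ w := by
        rw [lintegral_indicator hS, Measure.restrict_restrict hS, Set.inter_eq_left.mpr hSb]

end Cover

section Translates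

variable {E : Type*} [Field E] [NumberField E] {c : E ≃+* E} {H : Matrix (Fin 3) (Fin 3) E} {τ₀ : E →+* ℂ}
  {C : Matrix (Fin 3) (Fin 3) ℂ} {Γ Γ' : Set (Matrix (Fin 3) (Fin 3) E)}

omit [NumberField E] in
/-- The translates `r⁻¹(F)` of a subset of the ball lie in the ball (`r ∈ Γ`, `Γ` a congruence subgroup). -/
theorem translate_subset_ball (hΓ : IsCongruenceSubgroup c H Γ) (hτ : ∀ x, τ₀ (c x) = conj (τ₀ x))
    (hC : IsSylvester (H.map τ₀) C) {r : Matrix (Fin 3) (Fin 3) E} (hr : r ∈ Γ) {F : Set (Fin 2 → ℂ)}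
    (hFb : F ⊆ ball) : actM (toBallMat τ₀ C r) '' F ⊆ ball := by
  rintro _ ⟨z, hz, rfl⟩
  exact actM_mem_ball (toBallMat_unitaryJ hΓ hτ hC hr) (hFb hz)

omit [NumberField E] in
/-- **COVERING BY THE TRANSLATES**: for `F` a fundamental domain of `Γ`, `Γ′` a subset of matrices and
`R ⊆ Γ` representatives of the left cosets (`γ = r * δ`, `δ ∈ Γ′`), almost every point of the ball has a `Γ′`-translate
in `⋃_{r ∈ R} r⁻¹(F)` — here written with the inverses `r′ ∈ Γ` of the representatives (`r′ * r = 1`). -/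
theorem ae_exists_translate_mem_iUnion (hΓ : IsCongruenceSubgroup c H Γ)
    (hτ : ∀ x, τ₀ (c x) = conj (τ₀ x)) (hC : IsSylvester (H.map τ₀) C)
    {F : Set (Fin 2 → ℂ)} (hF : IsFundamentalDomainFor (ballActions τ₀ C Γ) F)
    {R : Set (Matrix (Fin 3) (Fin 3) E)} (hR : ∀ γ ∈ Γ, ∃ r ∈ R, ∃ δ ∈ Γ', γ = r * δ)
    (inv : Matrix (Fin 3) (Fin 3) E → Matrix (Fin 3) (Fin 3) E) (hinv : ∀ r ∈ R, inv r ∈ Γ ∧ inv r * r = 1) :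
    ∀ᵐ z ∂(volume.restrict ball), ∃ φ ∈ ballActions τ₀ C Γ',
      φ z ∈ ⋃ r : R, actM (toBallMat τ₀ C (inv r.1)) '' F := by
  filter_upwards [hF.2.2.1, ae_restrict_mem isOpen_ball.measurableSet] with z hz hzb
  obtain ⟨φ, ⟨γ, hγ, rfl⟩, hφz⟩ := hz
  obtain ⟨r, hr, δ, hδ, rfl⟩ := hR γ hγ
  obtain ⟨hinvΓ, hinvr⟩ := hinv r hr
  refine ⟨actM (toBallMat τ₀ C δ), ⟨δ, hδ, rfl⟩, ?_⟩
  rw [Set.mem_iUnion]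
  refine ⟨⟨r, hr⟩, actM (toBallMat τ₀ C (r * δ)) z, hφz, ?_⟩
  -- `inv r * (r * δ) = δ`, so `r⁻¹ ((r δ) z) = δ z`
  have hrδJ : (toBallMat τ₀ C (r * δ))ᴴ * J * toBallMat τ₀ C (r * δ) = J :=
    toBallMat_unitaryJ hΓ hτ hC hγ
  have h1 : actM (toBallMat τ₀ C (inv r)) (actM (toBallMat τ₀ C (r * δ)) z) =
      actM (toBallMat τ₀ C (inv r * (r * δ))) z := by
    rw [toBallMat_mul τ₀ hC.1 (inv r) (r * δ), actM_mul hrδJ hzb]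
  rw [h1, ← mul_assoc, hinvr, one_mul]

omit [NumberField E] in
/-- The union of finitely many measurable translates is measurable (`R` finite). -/
theorem measurableSet_iUnion_translates (hΓ : IsCongruenceSubgroup c H Γ) (hτ : ∀ x, τ₀ (c x) = conj (τ₀ x))
    (hC : IsSylvester (H.map τ₀) C) {F : Set (Fin 2 → ℂ)} (hFm : MeasurableSet F) (hFb : F ⊆ ball)
    {R : Set (Matrix (Fin 3) (Fin 3) E)} (hRf : R.Finite) (inv : Matrix (Fin 3) (Fin 3) E → Matrix (Fin 3) (Fin 3) E)
    (hinv : ∀ r ∈ R, inv r ∈ Γ) : MeasurableSet (⋃ r : R, actM (toBallMat τ₀ C (inv r.1)) '' F) := by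
  haveI : Countable R := hRf.countable.to_subtype
  exact MeasurableSet.iUnion fun r =>
    measurableSet_image_actM (toBallMat_unitaryJ hΓ hτ hC (hinv r.1 r.2)) hFm hFb

/-- **THE MASS OF AN INVARIANT DENSITY OVER A DOMAIN OF THE LEVEL IS AT MOST ITS MASS OVER THE TRANSLATES**:
`∫⁻_D ρ ≤ Σ_{r ∈ R} ∫⁻_{r⁻¹(F)} ρ` for `D` a fundamental domain of `Γ′`, `F` one of `Γ`, `R ⊆ Γ` representatives of
the left cosets of `Γ′` in `Γ` and `ρ` a `Γ′`-invariant density (`Γ′ ⊆ Γ` is not even needed). -/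
theorem lintegral_domain_le_sum_translates (hΓ : IsCongruenceSubgroup c H Γ) (hΓ' : IsCongruenceSubgroup c H Γ')
    (hτ : ∀ x, τ₀ (c x) = conj (τ₀ x)) (hC : IsSylvester (H.map τ₀) C)
    {D F : Set (Fin 2 → ℂ)} (hD : IsFundamentalDomainFor (ballActions τ₀ C Γ') D)
    (hF : IsFundamentalDomainFor (ballActions τ₀ C Γ) F)
    {R : Set (Matrix (Fin 3) (Fin 3) E)} (hRf : R.Finite) (hR : ∀ γ ∈ Γ, ∃ r ∈ R, ∃ δ ∈ Γ', γ = r * δ)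
    (inv : Matrix (Fin 3) (Fin 3) E → Matrix (Fin 3) (Fin 3) E) (hinv : ∀ r ∈ R, inv r ∈ Γ ∧ inv r * r = 1)
    {ρ : (Fin 2 → ℂ) → ℝ≥0∞} (hρm : AEMeasurable ρ (volume.restrict ball)) (hρ : IsInvariantDensity τ₀ C Γ' ρ) :
    ∫⁻ z in D, ρ z ≤ ∑' r : R, ∫⁻ z in actM (toBallMat τ₀ C (inv r.1)) '' F, ρ z := by
  haveI : Countable R := hRf.countable.to_subtype
  have hS : MeasurableSet (⋃ r : R, actM (toBallMat τ₀ C (inv r.1)) '' F) :=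
    measurableSet_iUnion_translates hΓ hτ hC hF.1 hF.2.1 hRf inv (fun r hr => (hinv r hr).1)
  have hSb : (⋃ r : R, actM (toBallMat τ₀ C (inv r.1)) '' F) ⊆ ball :=
    Set.iUnion_subset fun r => translate_subset_ball hΓ hτ hC (hinv r.1 r.2).1 hF.2.1
  calc ∫⁻ z in D, ρ z ≤ ∫⁻ z in ⋃ r : R, actM (toBallMat τ₀ C (inv r.1)) '' F, ρ z :=
        lintegral_fundamentalDomain_le_of_cover hΓ' hτ hC hD hS hSb
          (ae_exists_translate_mem_iUnion hΓ hτ hC hF hR inv hinv) hρm hρ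
    _ ≤ ∑' r : R, ∫⁻ z in actM (toBallMat τ₀ C (inv r.1)) '' F, ρ z := lintegral_iUnion_le _ _

end Translates

end Summit.Ventures.HodgeRepro.Tier4.Line3

end
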